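/-
Copyright: the b2b-balaban T⁴-continuum CRUX team, row NE7b OWNER lineage `t4-ne7b-p1` (gen 124). Project licence.
-/
import Summits.QuantumFields.BalabanUV.T4Continuum.Spine.NE7b.SupZdKernelNeumann
import Mathlib.Analysis.Normed.Group.Tannery

/-!
# KERNEL ALGEBRA ON `ℤ^d`, III: THE RESOLVENT IDENTITY IN THE DECAYING CLASS AND THE CONTINUITY OF INVERSES UNDER ENTRYWISE CONVERGENCE —
# `N_A − N_B = N_A(B − A)N_B` for bounded kernels `A, B` with a decaying left inverse `N_A` and a decaying right inverse `N_B` (Fubini on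
# `ℤ^d × ℤ^d`), and: if `T_k → T` ENTRYWISE with a uniform bound, the `T_k` have decaying left inverses `N_k` with UNIFORM constants and `T`
# has a decaying right inverse `N`, then `N_k → N` entrywise (Tannery on `ℤ^d × ℤ^d`).  The `ℤ^d` end of the torus → `ℤ^d` identification of
# next-scale Hessians for the `H + K` column — what (199) did for `T_0` through [B4] (5.10), now available without sections or floors
# (row NE7b, node U5c; (189)∕(191) BY NAME, Mathlib's Tannery theorem; [folklore])

Cell `pub-balaban`, sub-cell `t4`, spine estimate NE7b (`T4WeightBudget.RelWeightBound`; the cell's OWN estimate — NOT PRINTED in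
[Bałaban 1983–89], NOT PROVED).  Crux-route work under `Spine/NE7b/` by the row OWNER (`t4-ne7b-p1` gen 124, file (227)) under FREEZE
(0)'s crux-prover clause; NOTHING of Bałaban's is named as a Lean object, valued or asserted; no `T4Continuum/Support` leaf typed; no `def`
(one `where`-auxiliary THEOREM `resolvent_identity.hFsum_comm` = `Summable.tsum_comm` named), no notation; zero `sorry`; no road object
(pure kernel algebra).  Imports (BY NAME): the OWNER's (217) `…SupZdKernelNeumann` (through it (189) `summable_exp_l1`, (191)
`natAbs_sub_comm_sum`), Mathlib's `tendsto_tsum_of_dominated_convergence` (`Analysis.Normed.Group.Tannery`), `Summable.mul_of_nonneg`,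
`Summable.tsum_prod`, `Summable.prod`, `Summable.prod_factor`, `Summable.tsum_comm`, `squeeze_zero_norm`.

WHY (located).  The ADDENDUM's NEXT item (b): the torus → `ℤ^d` limit of the `H + K` tower.  Its `ℤ^d` end is an identification problem —
the torus coarse operators, transplanted to windows of `ℤ^d` ((196)–(198)'s pattern), converge entrywise to `T_K` with uniform decay, their
inverses are decaying with uniform constants ((226) gives them perturbatively, uniformly in the volume), and one wants the inverses to
converge to `N_K`.  For `T_0` (199) used the SECTION method and [B4] (5.10), which needs symmetry and a floor; for `T_K` neither is
available, but the resolvent identity is: `N_k − N = N_k(T − T_k)N` holds entrywise as an absolutely convergent double series (left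
inverse on the left, right inverse on the right, Fubini under `C_Ne^{−ν|b−c|₁}C_AC_Ne^{−ν|c′−b′|₁}`), its terms tend to `0` and are dominated
by the summable `C_Ne^{−ν|b−c|₁}·2C_A·C_Ne^{−ν|c′−b′|₁}` — Tannery.  No rate is claimed (entrywise convergence in, entrywise convergence out);
rates follow the same way from a rate on `T − T_k` ((199)'s exponential seam bound) and are the sequel.

WHAT IS PROVED ([folklore]): §1 **`resolvent_identity`** (summability of the triple family and `N_A(b,b′) − N_B(b,b′) =
Σ′_cΣ′_{c′}N_A(b,c)(B − A)(c,c′)N_B(c′,b′)`); §2 **`inverse_tendsto`** (THE END: `N_k(b,b′) → N(b,b′)`); §3 toy.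

HONEST (what this is NOT).  Abstract and qualitative (no rate); the torus side of (b) (window transplant of the `H + K` torus column, uniform
decay of the torus inverses, the seam estimate) is NOT here; nothing of the covariant propagators of [B4]–[B6]; nothing of Bałaban's
asserted.  BY-NAME EFFECT ON THE WALL: NONE.  NE7b NOT PRINTED ∕ NOT PROVED; spine PROVED 0∕9; rung (B)+1 — the programme's measures remain
FINITE-torus statements; NOT the mass gap, NOT Clay.  HONEST DEPENDENCY: continuum YM on T⁴ ⇐ BetaPertH ∧ nine spine estimates (0∕9
proved); BetaPertH ⇐ (D1) ∧ (D4) ∧ CAP+tail; G-an2-4 gates asym, D1 and NE2∕3∕4.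
-/

set_option autoImplicit false

noncomputable section

namespace Summit.QuantumFields.BalabanUV.T4Continuum.NE7b.SupZdKernelInverseLimit

open Real Filter Topology
open scoped ENNReal
open Literature.MathematicalPhysics.QuantumFieldTheory.Balaban1983to89
open B6QGQLower276 (X)
open SupZdExponentialSums (summable_exp_l1)
open SupZdCoarseForm (natAbs_sub_comm_sum)

variable {d : ℕ}

/-! ## §1. The resolvent identity in the decaying class -/

/-- **RESOLVENT IDENTITY ON `ℤ^d`**: `A, B` bounded kernels, `N_A` a decaying LEFT inverse of `A` (`N_AA = 1`), `N_B` a decaying RIGHT inverse of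
`B` (`BN_B = 1`) ⟹ the triple family `N_A(b,c)(B − A)(c,c′)N_B(c′,b′)` is absolutely summable on `ℤ^d × ℤ^d` and
`N_A(b,b′) − N_B(b,b′) = Σ′_cΣ′_{c′}N_A(b,c)(B(c,c′) − A(c,c′))N_B(c′,b′)` — `N_A(B − A)N_B = (N_AB)N_B − N_A(AN_B)`… i.e. `N_ABN_B − N_AAN_B = N_A − N_B`
by Fubini under `C_Ne^{−ν|b−c|₁}·C_A·C_Ne^{−ν|c′−b′|₁}`. [folklore] -/
theorem resolvent_identity {CA Cn ν : ℝ} (hCA : 0 ≤ CA) (hCn : 0 ≤ Cn) (hν : 0 < ν) (A B NA NB : X d → X d → ℝ)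
    (hA : ∀ c c', |A c c'| ≤ CA) (hB : ∀ c c', |B c c'| ≤ CA)
    (hNA : ∀ b c, |NA b c| ≤ Cn * exp (-(ν * ∑ i, (((b i - c i).natAbs : ℕ) : ℝ))))
    (hNB : ∀ b c, |NB b c| ≤ Cn * exp (-(ν * ∑ i, (((b i - c i).natAbs : ℕ) : ℝ))))
    (hNAA : ∀ b c', ∑' c : X d, NA b c * A c c' = if b = c' then 1 else 0)
    (hBNB : ∀ c b', ∑' c' : X d, B c c' * NB c' b' = if c = b' then 1 else 0) (b b' : X d) :
    Summable (fun x : X d × X d => NA b x.1 * (B x.1 x.2 - A x.1 x.2) * NB x.2 b') ∧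
    NA b b' - NB b b' = ∑' c : X d, ∑' c' : X d, NA b c * (B c c' - A c c') * NB c' b' := by
  classical
  have hNBc : ∀ c', |NB c' b'| ≤ Cn * exp (-(ν * ∑ i, (((b' i - c' i).natAbs : ℕ) : ℝ))) := fun c' => by
    rw [natAbs_sub_comm_sum]; exact hNB c' b'
  -- the dominating product family
  have hprod : Summable fun x : X d × X d => (Cn * exp (-(ν * ∑ i, (((b i - x.1 i).natAbs : ℕ) : ℝ))) * CA)
      * (Cn * exp (-(ν * ∑ i, (((b' i - x.2 i).natAbs : ℕ) : ℝ)))) :=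
    Summable.mul_of_nonneg (((summable_exp_l1 hν b).mul_left Cn).mul_right CA) ((summable_exp_l1 hν b').mul_left Cn)
      (fun _ => by positivity) (fun _ => by positivity)
  -- the two triple families `N_A·B·N_B`, `N_A·A·N_B`
  have hsum : ∀ (Cm : X d → X d → ℝ), (∀ c c', |Cm c c'| ≤ CA) →
      Summable (fun x : X d × X d => NA b x.1 * Cm x.1 x.2 * NB x.2 b') := by
    intro Cm hCm
    refine Summable.of_norm_bounded hprod fun x => ?_
    rw [Real.norm_eq_abs, abs_mul, abs_mul]
    exact mul_le_mul (mul_le_mul (hNA b x.1) (hCm x.1 x.2) (abs_nonneg _) (by positivity)) (hNBc x.2) (abs_nonneg _) (by positivity)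
  have hsB := hsum B hB
  have hsA := hsum A hA
  have hsub : Summable (fun x : X d × X d => NA b x.1 * (B x.1 x.2 - A x.1 x.2) * NB x.2 b') :=
    (hsB.sub hsA).congr fun x => by ring
  refine ⟨hsub, ?_⟩
  -- `Σ_c Σ_c′ N_A B N_B = N_A(b,b′)`
  have h1 : ∑' c : X d, ∑' c' : X d, NA b c * B c c' * NB c' b' = NA b b' := by
    have e : ∀ c, ∑' c' : X d, NA b c * B c c' * NB c' b' = NA b c * (if c = b' then 1 else 0) := fun c => by
      rw [← hBNB c b', ← tsum_mul_left]; exact tsum_congr fun c' => by ring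
    rw [tsum_congr e, tsum_eq_single b' (fun c (hc : c ≠ b') => by rw [if_neg hc, mul_zero]), if_pos rfl, mul_one]
  -- `Σ_c Σ_c′ N_A A N_B = N_B(b,b′)` (Fubini)
  have h2 : ∑' c : X d, ∑' c' : X d, NA b c * A c c' * NB c' b' = NB b b' := by
    obtain ⟨F, hF⟩ : ∃ F : X d → X d → ℝ, ∀ c c', F c c' = NA b c * A c c' * NB c' b' := ⟨_, fun _ _ => rfl⟩
    have hFs : Summable (Function.uncurry F) := hsA.congr fun x => by simp only [Function.uncurry, hF]
    have e1 : ∀ c, ∑' c' : X d, NA b c * A c c' * NB c' b' = ∑' c' : X d, F c c' := fun c => tsum_congr fun c' => by rw [hF]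
    rw [tsum_congr e1, ← hFsum_comm F hFs]
    have e2 : ∀ c', ∑' c : X d, F c c' = (if b = c' then 1 else 0) * NB c' b' := fun c' => by
      simp only [hF]; rw [← hNAA b c', ← tsum_mul_right]
    rw [tsum_congr e2, tsum_eq_single b (fun c' (hc' : c' ≠ b) => by rw [if_neg (fun h => hc' h.symm), zero_mul]), if_pos rfl, one_mul]
  -- assemble
  have hinner : ∀ c, Summable (fun c' : X d => NA b c * B c c' * NB c' b') ∧ Summable (fun c' : X d => NA b c * A c c' * NB c' b') := by
    intro c
    have hB' := hsB.prod_factor c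
    have hA' := hsA.prod_factor c
    exact ⟨hB', hA'⟩
  have e3 : ∀ c, ∑' c' : X d, NA b c * (B c c' - A c c') * NB c' b'
      = ∑' c' : X d, NA b c * B c c' * NB c' b' - ∑' c' : X d, NA b c * A c c' * NB c' b' := fun c => by
    rw [← (hinner c).1.tsum_sub (hinner c).2]; exact tsum_congr fun c' => by ring
  have houtB : Summable fun c : X d => ∑' c' : X d, NA b c * B c c' * NB c' b' := hsB.prod
  have houtA : Summable fun c : X d => ∑' c' : X d, NA b c * A c c' * NB c' b' := hsA.prod
  rw [tsum_congr e3, houtB.tsum_sub houtA, h1, h2]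
  where
  /-- Fubini for an absolutely summable family on `ℤ^d × ℤ^d` (named to keep the main proof readable). -/
  hFsum_comm (F : X d → X d → ℝ) (hFs : Summable (Function.uncurry F)) :
      ∑' c' : X d, ∑' c : X d, F c c' = ∑' c : X d, ∑' c' : X d, F c c' := hFs.tsum_comm

/-! ## §2. THE END: decaying inverses converge when the kernels converge entrywise -/

/-- **HEADLINE — INVERSES IN THE DECAYING CLASS ARE CONTINUOUS UNDER ENTRYWISE CONVERGENCE**: kernels `T_k → T` entrywise on `ℤ^d`, all
bounded by `C_A`; `N_k` decaying LEFT inverses of `T_k` with UNIFORM constants (`|N_k(b,c)| ≤ C_Ne^{−ν|b−c|₁}`, `N_kT_k = 1`); `N` a decaying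
RIGHT inverse of `T` (`TN = 1`) ⟹ `N_k(b,b′) → N(b,b′)` for all `b, b′` — the resolvent identity `N_k − N = N_k(T − T_k)N` (§1) and Tannery's
theorem on `ℤ^d × ℤ^d` under `C_Ne^{−ν|b−c|₁}·2C_A·C_Ne^{−ν|c′−b′|₁}`.  The `ℤ^d` end of the torus → `ℤ^d` identification of next-scale
Hessians: uniform decay + entrywise convergence of the (transplanted) coarse operators forces convergence of their inverses to THE
decaying inverse. [folklore] -/
theorem inverse_tendsto {CA Cn ν : ℝ} (hCA : 0 ≤ CA) (hCn : 0 ≤ Cn) (hν : 0 < ν)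
    (Tk : ℕ → X d → X d → ℝ) (Nk : ℕ → X d → X d → ℝ) (T N : X d → X d → ℝ)
    (hTk : ∀ k c c', |Tk k c c'| ≤ CA) (hT : ∀ c c', |T c c'| ≤ CA)
    (hNk : ∀ k b c, |Nk k b c| ≤ Cn * exp (-(ν * ∑ i, (((b i - c i).natAbs : ℕ) : ℝ))))
    (hN : ∀ b c, |N b c| ≤ Cn * exp (-(ν * ∑ i, (((b i - c i).natAbs : ℕ) : ℝ))))
    (hNkTk : ∀ k b c', ∑' c : X d, Nk k b c * Tk k c c' = if b = c' then 1 else 0)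
    (hTN : ∀ c b', ∑' c' : X d, T c c' * N c' b' = if c = b' then 1 else 0)
    (hlim : ∀ c c', Tendsto (fun k => Tk k c c') atTop (𝓝 (T c c'))) (b b' : X d) :
    Tendsto (fun k => Nk k b b') atTop (𝓝 (N b b')) := by
  classical
  have hNc : ∀ c', |N c' b'| ≤ Cn * exp (-(ν * ∑ i, (((b' i - c' i).natAbs : ℕ) : ℝ))) := fun c' => by
    rw [natAbs_sub_comm_sum]; exact hN c' b'
  -- the resolvent identity for each `k`, as ONE series over `ℤ^d × ℤ^d`
  obtain ⟨G, hG⟩ : ∃ G : ℕ → X d × X d → ℝ, ∀ k x, G k x = Nk k b x.1 * (T x.1 x.2 - Tk k x.1 x.2) * N x.2 b' := ⟨_, fun _ _ => rfl⟩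
  have hres : ∀ k, Summable (G k) ∧ Nk k b b' - N b b' = ∑' x : X d × X d, G k x := by
    intro k
    obtain ⟨hs, hid⟩ := resolvent_identity (d := d) hCA hCn hν (Tk k) T (Nk k) N (hTk k) hT (hNk k) hN (hNkTk k) hTN b b'
    have hs' : Summable (G k) := hs.congr fun x => by rw [hG]
    refine ⟨hs', ?_⟩
    rw [hid, hs'.tsum_prod]
    exact tsum_congr fun c => tsum_congr fun c' => by simp only [hG]
  -- Tannery: domination and pointwise convergence to `0`
  obtain ⟨bound, hbound⟩ : ∃ bound : X d × X d → ℝ, ∀ x, bound x = (Cn * exp (-(ν * ∑ i, (((b i - x.1 i).natAbs : ℕ) : ℝ))) * (2 * CA))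
      * (Cn * exp (-(ν * ∑ i, (((b' i - x.2 i).natAbs : ℕ) : ℝ)))) := ⟨_, fun _ => rfl⟩
  have hbs : Summable bound := by
    have h := Summable.mul_of_nonneg (((summable_exp_l1 hν b).mul_left Cn).mul_right (2 * CA)) ((summable_exp_l1 hν b').mul_left Cn)
      (fun _ => by positivity) (fun _ => by positivity)
    exact h.congr fun x => by rw [hbound]
  have hdiffb : ∀ (k : ℕ) (x : X d × X d), |T x.1 x.2 - Tk k x.1 x.2| ≤ 2 * CA := fun k x =>
    (abs_sub _ _).trans (by linarith [hT x.1 x.2, hTk k x.1 x.2])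
  have hdom : ∀ (k : ℕ) (x : X d × X d), ‖G k x‖ ≤ bound x := by
    intro k x
    rw [Real.norm_eq_abs, hG, hbound, abs_mul, abs_mul]
    exact mul_le_mul (mul_le_mul (hNk k b x.1) (hdiffb k x) (abs_nonneg _) (by positivity)) (hNc x.2) (abs_nonneg _) (by positivity)
  have hpt : ∀ x : X d × X d, Tendsto (fun k => G k x) atTop (𝓝 0) := by
    intro x
    have h0 : Tendsto (fun k => T x.1 x.2 - Tk k x.1 x.2) atTop (𝓝 0) := by
      have h := (hlim x.1 x.2).const_sub (T x.1 x.2)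
      rw [sub_self] at h
      exact h
    have hb : ∀ k, |G k x| ≤ Cn * |T x.1 x.2 - Tk k x.1 x.2| * Cn := by
      intro k
      rw [hG, abs_mul, abs_mul]
      refine mul_le_mul (mul_le_mul_of_nonneg_right ?_ (abs_nonneg _)) ?_ (abs_nonneg _) (by positivity)
      · exact (hNk k b x.1).trans (mul_le_of_le_one_right hCn (exp_le_one_iff.2 (neg_nonpos.2 (by positivity))))
      · exact (hNc x.2).trans (mul_le_of_le_one_right hCn (exp_le_one_iff.2 (neg_nonpos.2 (by positivity))))
    have hlim0 : Tendsto (fun k => Cn * |T x.1 x.2 - Tk k x.1 x.2| * Cn) atTop (𝓝 0) := by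
      have h := (h0.abs.const_mul Cn).mul_const Cn
      rw [abs_zero, mul_zero, zero_mul] at h
      exact h
    exact squeeze_zero_norm (fun k => by rw [Real.norm_eq_abs]; exact hb k) hlim0
  have hT : Tendsto (fun k => ∑' x : X d × X d, G k x) atTop (𝓝 (∑' x : X d × X d, (0 : ℝ))) :=
    tendsto_tsum_of_dominated_convergence hbs hpt (Eventually.of_forall hdom)
  rw [tsum_zero] at hT
  have h := hT.add_const (N b b')
  rw [zero_add] at h
  refine h.congr fun k => ?_
  rw [← (hres k).2]; ring

/-! ## §3. Toy -/

/-- Toy (`d = 2`): a constant sequence of kernels converges entrywise — the shape of `inverse_tendsto`'s last hypothesis. -/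
example (T : X 2 → X 2 → ℝ) (c c' : X 2) : Tendsto (fun _ : ℕ => T c c') atTop (𝓝 (T c c')) := tendsto_const_nhds

end Summit.QuantumFields.BalabanUV.T4Continuum.NE7b.SupZdKernelInverseLimit
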